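import Summits.CriticalPhenomena.SAWScalingLimit.Theorems.HexConjecture.Negative.LoadBearing
import Summits.CriticalPhenomena.SAWScalingLimit.Theorems.HexConjecture.Negative.NonVacuity
import Summits.CriticalPhenomena.SAWScalingLimit.Theorems.HexConjecture.Negative.BoundaryWitness
import Summits.CriticalPhenomena.SAWScalingLimit.Theorems.HexConjecture.Negative.Reversal
import Summits.CriticalPhenomena.SAWScalingLimit.Theorems.HexConjecture.Negative.MeshFilter
import Summits.CriticalPhenomena.SAWScalingLimit.Theorems.ObservableToSLE.Negative.TightnessNecessity
import Summits.CriticalPhenomena.SAWScalingLimit.Theorems.ObservableToSLE.Negative.DeepEndpoints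
import Summits.CriticalPhenomena.SAWScalingLimit.Theorems.ObservableToSLE.Negative.Identification

/-!
# Disproof of `HexConjecture` (crux `stmt-CriticalPhenomena-0808`) — standing disprover's work file
(cdisprove generation 3, cycle 2; supersedes the gen-1/gen-2 evidence files
`run/gate/evidence/stmt-CriticalPhenomena-0808/*-Disproof.lean`, whose path is NOT mounted in seat jails —
this copy is published in the tree at `Cruxes/HexConjecture/Disproof.lean` so that every seat can read it).

The crux (identical bodies in `Theses.SAWDefectDecoherence`, `.SAWHexUniversality`, `.SAWBrickWallHomotopy`,
`.SAWResidueField`, `.SAWDevelopingMap`, …; `Iff.rfl` with `Literature…SAW.HexSAWScalingLimit`):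

  `HexConjecture : ∀ (D : DobrushinDomain) (a b : ℝ → HexVertex),
      IsEmbEndpointApprox hexGraph hexCenter D a b →
      ConvergesInLawToSLE (8/3) D (fun δ γ ↦ γ.curve) (fun δ ↦ hexSAWLaw D.carrier δ (a δ) (b δ))`

= Duminil-Copin–Smirnov 2012 Conjecture 1 (critical hexagonal SAW ⇒ chordal SLE(8/3)), for EVERY bounded
Jordan domain with two marks and EVERY endpoint approximation (eventually reachable in `Ω_δ`, rescaled
endpoints converging to the marks — interior lattice endpoints allowed).

## VERDICT SO FAR: the crux RESISTS (no kill). Why: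
* it is a faithful typing of an open conjecture believed true; a substantive refutation would disprove
  SAW ⇒ SLE(8/3);
* the SLE side is sound modulo TRUE named facts: `IsSLECurve` asks a.e. (outer measure, so null sets of
  the product σ-algebra are harmless) for the Loewner chain of `√κ·brownian` (a continuous modification,
  junk `0` only in the contradictory case) to be generated by its trace and for the class of the
  compactified image under the boundary extension of a chordal uniformiser; `preWienerMeasure` is a
  probability measure (`isProbabilityMeasure_preWienerMeasure'`, PROVED); uniqueness in law
  `IsSLECurve.map_eq_holds` PROVED; `JordanDomain` carries its Jordan curve as data (carrier open,
  bounded, connected, frontier = the loop) — no junk inhabitant exists classically;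
* the SAW side: `embMeshDomain` = largest component(s) of the mesh graph (edges whose rescaled segment
  stays in `closure Ω`), laws normalised, junk `0` only when unreachable; every junk regime is excluded
  EVENTUALLY by `IsEmbEndpointApprox` (and each of its three clauses is load-bearing, §1). Pathologies
  searched and found NOT formalisable into a counterexample: tied largest components (symmetry ties die for
  small δ since `Ω ∩ axis` contains an interval), macroscopic secondary components (killed by uniform local
  connectivity of a Jordan curve), fat (positive-area) boundaries, thin exterior fingers (only within o(1)
  of their tips).

## FINDINGS = checked theorems (this file only INDEXES landed ones; new ones are inline, §4–§5)

§1 LOAD-BEARING (landed `Theorems/HexConjecture/Negative/LoadBearing.lean`, p69738):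
  `Negative.hexConjecture_false_without_tendsto_snd / _fst / _reachable` — the crux with any one clause of
  `IsEmbEndpointApprox` dropped is FALSE (unit disc; Dirac law at a constant curve / empty SAW space).
  Also `ObservableToSLE.Negative.EndpointNecessity`: the conclusion FORCES all three clauses
  (`isEmbEndpointApprox_of_convergesInLawToSLE`) — the hypothesis is exactly the necessary condition.
§2 NON-VACUITY / EXISTENCE DEBT (landed `…/Negative/NonVacuity.lean`, p70214):
  `NonVacuity.isEmbEndpointApprox_unitDisc` (disc mesh graph connected through the disc, `Ω_δ = δℍ ∩ 𝔻`);
  `exists_isSLECurve_unitDisc_of_hexConjecture` — ANY proof constructs a chordal SLE(8/3) random curve in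
  the unit disc (an instance of the unproved named fact `exists_isSLECurve`: Rohde–Schramm trace,
  transience, Carathéodory); `isProbabilityMeasure_preWiener_of_hexConjecture`.
  `ObservableToSLE.Negative.DeepEndpoints.exists_isEmbEndpointApprox_deep` (other seat): approximations
  with source at LATTICE depth `≥ δ^{-1/2} → ∞` are legitimate — the crux is strictly wider than DCS's
  printed "closest boundary vertices" reading (residual "endpoint universality" of every observable line).
§3 PRINTED READING & REFUTED STRENGTHENINGS (landed `…/Negative/BoundaryWitness.lean`, p70404):
  `Boundary.HexConjectureBoundaryEndpoints` (boundary lattice endpoints) is implied by the crux and is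
  non-vacuous (`isEmbEndpointApprox_unitDisc_boundary`, zigzag exit); NOT probability for every δ
  (`not_forall_isProbabilityMeasure_hexSAWLaw`, `meshBall_four_eq_empty`); the fugacity-0 crux is FALSE
  (`hexConjectureAtFugacity_zero_false`), the crux is the `x = x_c` instance (`hexConjectureAtFugacity_critical`).
§3b STRUCTURE (other seat, landed `Theorems/ObservableToSLE/Negative/TightnessNecessity.lean`):
  `hexTight_of_hexConjecture : HexConjecture → HexTight`, `hexConjecture_iff_tight_and_identification :
  HexConjecture ↔ HexTight ∧ (identification of subsequential limits)` — tightness (crux stmt-5423) is a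
  CONSEQUENCE of the crux, no line can bypass it; proved with the lattice (finitely many supports per mesh
  window), NOT softly: see §5.
§4 NEW (cycle 2, LANDED `Theorems/HexConjecture/Negative/Reversal.lean`, p74061; anchors below):
  REVERSIBILITY DEBT. Exact lattice reversibility `hexSAWLaw Ω δ v u = (hexSAWLaw Ω δ u v).map sawReverse`,
  `(sawReverse γ).curve = reverse γ.curve`; hence `map_reverse_eq_of_tendstoLaw` (limits in law of the
  forward and backward families are time reversals of each other) and
  `isSLELaw_swap_of_hexConjecture : HexConjecture → IsSLELaw (8/3) D μ → IsSLELaw (8/3) D.swap (μ.map reverse)`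
  on every Dobrushin domain carrying a hexagonal endpoint approximation (unconditionally on the unit disc),
  `sleLaw_swap_eq_map_reverse_of_hexConjecture`: ANY proof of the crux proves Zhan's reversibility of
  chordal SLE(8/3) (Ann. Probab. 2008, κ ≤ 4; LSW 2003 for 8/3) — a theorem the tree does NOT have
  (`ChordalReversibility.lean` only defines `ChordalFamily.IsReversible`). Informs the lines: an
  identification engine rooted at `a` and normalised at `b` (observable/martingale) outputs a reversible
  law only at the very end; restriction lines (`root-locality-replaces-loewner`) get it for free.
  Family form (addendum LANDED `…/Negative/ReversalFamily.lean`, p76023): `isSLELaw_iff_of_eq` (SLE-ness depends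
  on `D` only via `(carrier, pt 0, pt 1)`), `Reversal.isReversible_sleFamily` — under the crux a selection of
  SLE(8/3) laws on approximable domains is a `ChordalFamily` satisfying `ChordalFamily.IsReversible`,
  i.e. hypothesis (iv) of crux `Rigidity` (route SAWRestrictionRigidity) follows from DCS Conjecture 1.
§5 NEW (cycle 2, LANDED `Theorems/HexConjecture/Negative/MeshFilter.lean`, p74907; anchor below):
  `not_isTightAlongMesh_of_tendstoLaw` — along the UNCOUNTABLE filter `𝓝[>] 0`, convergence in law does NOT
  imply `IsTightAlongMesh` for abstract families (Dirac witness on `ℕ → ℝ`); so "convergent ⇒ tight" is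
  not a soft step in this library, and §3b genuinely needs the lattice.

## TARGETS (lead's stubs): none yet — no `PICKED.md`; payload `targets = []`, `stuck_stubs = []`.
Cheap attacks already run on the two registered skeletons (no kill; details for the lead):
* `Lines/marginal-reflex-wedge-cauchy-kernel.lean`: `stub_reflexFluxLine` — dart partition and the two
  rigid windings verified on paper for ALL `N ≥ 1` (an edge crossing the positive real axis is vertical:
  both endpoints have `|im c| ≥ √3/6` and a ±30° edge has vertical extent `√3/6`; Hopf: the closed curve
  SAW + axis segment bounds a region on the wedge side of the segment ⇒ counter-clockwise ⇒ `W = +π`);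
  `stub_coneExteriorEscape` — monotonicity `Z_{W_N} ≤ Z_{Λ'}` holds even when `cornerOut ∈ Λ'`
  (`HexMidEdgeSAW.fst_mem` only asks ONE endpoint of the root in `Λ'`; walks of `W_N` inject);
  `stub_reflexCellCeiling` — CFT-consistent and open (corner weight `h(5π/3) = 3/8`, `3/8 + 5/8 = 1`;
  `D_N = Z₀ − Z₆₀` bounded because the reflection-ODD corner operator has weight `(3/5)(13/8) = 39/40`,
  so the ray asymmetry is summable `Σ r^{-39/40-5/8}`) — not refutable here, no rigorous upper-bound
  technology either; `HexTraversalBound` — since `k x ρ R` is free per shell, the statement is equivalent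
  to per-shell uniform-in-δ smallness of ONE tail level, exactly what the tree criterion
  `isTightMeasureSet_of_traversalBounds` (also free `k`) consumes: consistent, open.
* `Lines/root-locality-replaces-loewner.lean`: `CurveUpgrade` — deterministic core is right (a non-monotone
  traversal of a simple arc with correct endpoints has three disjoint up/down/up-crossings of a level
  interval, i.e. a triple strand with ε = 0); `RangeIdentification` — avoidance of boundary hulls cannot
  separate `K` from `fill K`, but the fill of a subsequential limit has the SLE(8/3) law (π-system of
  hull-avoidance events on filled sets) and a connected `K ⊆ simple arc` containing both marks is the arc:
  plausible as typed. No kill on either abstract stub.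
-/

noncomputable section

namespace Summit.CriticalPhenomena.SAWScalingLimit.Cruxes.HexConjecture.Disproof

open MeasureTheory Filter Topology Set
open Literature.Probability.LatticeModels Literature.Probability.RandomPlanarGeometry
open Literature.Probability.RandomPlanarGeometry.SAW Literature.Probability.Process
open scoped NNReal ENNReal

/-! ## §0 The crux and its clones are one statement -/

/-- The route decl IS the Literature open statement `HexSAWScalingLimit`. [folklore] -/
theorem hexConjecture_iff_hexSAWScalingLimit :
    Theses.SAWDefectDecoherence.HexConjecture ↔ HexSAWScalingLimit := Iff.rfl

/-- … and the clone in `SAWDevelopingMap` (the decl the sibling seats' theorems are stated for). [folklore] -/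
theorem hexConjecture_iff_developingMap :
    Theses.SAWDefectDecoherence.HexConjecture ↔ Theses.SAWDevelopingMap.HexConjecture := Iff.rfl

/-! ## §1–§3b Anchors into the landed negatives (see the module docstring for the index) -/

/-- §1 anchor: clause (iii) of `IsEmbEndpointApprox` is load-bearing. [folklore] -/
example : ¬ Negative.HexConjectureWithoutTendstoSnd := Negative.hexConjecture_false_without_tendsto_snd

/-- §2 anchor: the crux constructs an SLE(8/3) curve in the unit disc. [folklore] -/
example (h : Theses.SAWDefectDecoherence.HexConjecture) :
    ∃ Γ, IsSLECurve ((8 : ℝ≥0) / 3) DobrushinDomain.unitDisc Γ :=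
  NonVacuity.exists_isSLECurve_unitDisc_of_hexConjecture h

/-- §3b anchor: tightness is necessary (other seat's theorem, restated for this route's decls). [folklore] -/
theorem hexTight_of_hexConjecture' (h : Theses.SAWDefectDecoherence.HexConjecture) :
    Theses.SAWDefectDecoherence.HexTight :=
  Theorems.ObservableToSLE.Negative.hexTight_of_hexConjecture h

end Summit.CriticalPhenomena.SAWScalingLimit.Cruxes.HexConjecture.Disproof

/-! ## §4 NEW (cycle 2): reversal — LANDED as `Theorems/HexConjecture/Negative/Reversal.lean` (p74061,
commit f1246c62dfb5); anchors only (import above). -/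

namespace Summit.CriticalPhenomena.SAWScalingLimit.Cruxes.HexConjecture.Disproof

open MeasureTheory
open Literature.Probability.LatticeModels Literature.Probability.RandomPlanarGeometry
open Literature.Probability.RandomPlanarGeometry.SAW
open scoped NNReal

/-- §4 anchor (lattice): the critical hexagonal SAW law is EXACTLY reversible at every mesh. [folklore] -/
example (Ω : Set ℂ) (δ : ℝ) (u v : HexVertex) :
    hexSAWLaw Ω δ v u = (hexSAWLaw Ω δ u v).map Reversal.sawReverse :=
  Reversal.hexSAWLaw_swap Ω δ u v

/-- §4 anchor (debt): under the crux, time reversal maps SLE(8/3) laws of `(D; a, b)` to SLE(8/3) laws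
of `(D; b, a)` on every Dobrushin domain carrying a hexagonal endpoint approximation. [folklore] -/
example (h : Theses.SAWDefectDecoherence.HexConjecture) {D : DobrushinDomain}
    (hD : ∃ a b : ℝ → HexVertex, IsEmbEndpointApprox hexGraph hexCenter D a b)
    {μ : Measure (CurveClass ℂ)} (hμ : IsSLELaw ((8 : ℝ≥0) / 3) D μ) :
    IsSLELaw ((8 : ℝ≥0) / 3) D.swap (μ.map CurveClass.reverse) :=
  Reversal.isSLELaw_swap_of_hexConjecture h hD hμ

/-- §4 anchor (debt, unconditional): the unit disc. [folklore] -/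
example (h : Theses.SAWDefectDecoherence.HexConjecture) {μ : Measure (CurveClass ℂ)}
    (hμ : IsSLELaw ((8 : ℝ≥0) / 3) DobrushinDomain.unitDisc μ) :
    IsSLELaw ((8 : ℝ≥0) / 3) DobrushinDomain.unitDisc.swap (μ.map CurveClass.reverse) :=
  Reversal.isSLELaw_swap_unitDisc_of_hexConjecture h hμ

end Summit.CriticalPhenomena.SAWScalingLimit.Cruxes.HexConjecture.Disproof

/-! ## §5 NEW (cycle 2): the mesh-filter pitfall — LANDED as `Theorems/HexConjecture/Negative/MeshFilter.lean`
(p74907, commit 1ff792983d04); anchor only (import above). -/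

namespace Summit.CriticalPhenomena.SAWScalingLimit.Cruxes.HexConjecture.Disproof

open MeasureTheory Literature.Probability.RandomPlanarGeometry

/-- §5 anchor: convergence in law along `𝓝[>] 0` does not imply `IsTightAlongMesh` for abstract families. [folklore] -/
example : ¬ ∀ (Ωδ : ℝ → Type) (_ : ∀ δ, MeasurableSpace (Ωδ δ)) (X : Type) (_ : TopologicalSpace X)
    (Y : ∀ δ, Ωδ δ → X) (P : ∀ δ, Measure (Ωδ δ)) (Ω' : Type) (_ : MeasurableSpace Ω') (Z : Ω' → X)
    (P' : Measure Ω'), (∀ δ, IsProbabilityMeasure (P δ)) → IsProbabilityMeasure P' →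
    TendstoLaw Y P Z P' → IsTightAlongMesh Y P :=
  MeshFilter.not_isTightAlongMesh_of_tendstoLaw

end Summit.CriticalPhenomena.SAWScalingLimit.Cruxes.HexConjecture.Disproof
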